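import Mathlib
import HarnessLib
import Summits.NavierStokesRegularity.NavierStokesRegularity.Theorems.UnthreadedDoorAntidynamoSingleDegreeRungOfCrux
import Summits.NavierStokesRegularity.NavierStokesRegularity.Theorems.UnthreadedDoorAntidynamoSingleDegreeRungOdd

/-!
# Route `UnthreadedDoor` / `ThreadingFlux`, crux `PoloidalLiouville` (stmt-NavierStokesRegularity-1222), antidynamo v2 skeleton
# (sha16 `4ebf5683127b`): THE BC5 RUNG `stub_singleDegreeRung` IS ITS EVEN-DEGREE HALF, BY NAME

Census bookkeeping file (decomp-ns census instrument g27), `--supports stmt-NavierStokesRegularity-1222 --as helper`; theorems only,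
no new definitions. The registered rung `StubSingleDegreeRung` (Theorems/UnthreadedDoorAntidynamoSingleDegreeRungOfCrux.lean: a bounded
ancient mild solution, measurable slices, jointly smooth, whose slices have the single-degree form
`v t x = ∇φ + (g ‖x − x₀‖ · P(x − x₀)) • (x − x₀)` for a solid harmonic `P` of degree `l ≥ 2`, is slice-wise constant) SPLITS EXACTLY by the
parity of the degree `l` (`Nat.even_or_odd`): the ODD half is the leaf hand's tree theorem `singleDegreeRung_odd` (p798877, parity ⟹ odd
bounded ancient caloric vorticity ⟹ 0), so the rung is EQUIVALENT to its EVEN-degree half, stated here with the registered text verbatim plus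
the one conjunct `Even l` (no abbreviation introduced). The even half contains the axisymmetric-no-swirl content at `l = 2` (KNSS 2009 Thm 5.2
for zonal `P`) and is open in print for general even `P`; parity only reduces it (`singleDegreeRung_even_parity`, p798954). Conditional /
exactness facts crediting nothing; nothing here proves the rung, the wall `StubScalarLiouville`, `PoloidalLiouville` (1222), or bears on
Navier–Stokes regularity (rung 0). [folklore]
-/

noncomputable section

-- the summit and its single sub-problem share the name (CONVENTIONS §1)
set_option linter.dupNamespace false

open scoped Topology InnerProductSpace RealInnerProductSpace ContDiff
open Filter Set Function Metric MeasureTheory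
open Literature.Analysis.FluidPDE

namespace Summit.NavierStokesRegularity.NavierStokesRegularity.Theorems.PoloidalLiouville.Antidynamo

/-- **The registered rung follows from its even-degree half** (the odd half being the tree theorem `singleDegreeRung_odd`):
hypothesis `heven` is the registered text of `StubSingleDegreeRung` with the single extra conjunct `Even l`. [folklore] -/
theorem stubSingleDegreeRung_of_even
    (heven : ∀ (v : ℝ → EuclideanSpace ℝ (Fin 3) → EuclideanSpace ℝ (Fin 3)) (x₀ : EuclideanSpace ℝ (Fin 3)),
      Literature.Analysis.FluidPDE.IsBoundedAncientMildSolution 1 v →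
      (∀ t < 0, AEStronglyMeasurable (v t) volume) →
      ContDiffOn ℝ (⊤ : ℕ∞) (Function.uncurry v) (Set.Iio 0 ×ˢ Set.univ) →
      (∃ (l : ℕ) (P : MvPolynomial (Fin 3) ℝ), 2 ≤ l ∧ Even l ∧ P.IsHomogeneous l ∧
        (∀ y : EuclideanSpace ℝ (Fin 3),
          Laplacian.laplacian (fun z : EuclideanSpace ℝ (Fin 3) => MvPolynomial.eval (fun i => z i) P) y = 0) ∧
        ∀ t < 0, ∃ (g : ℝ → ℝ) (φ : EuclideanSpace ℝ (Fin 3) → ℝ), ∀ x,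
          v t x = gradient φ x + (g ‖x - x₀‖ * MvPolynomial.eval (fun i => (x - x₀) i) P) • (x - x₀)) →
      ∀ t < 0, ∃ b : EuclideanSpace ℝ (Fin 3), ∀ x, v t x = b) :
    StubSingleDegreeRung := by
  intro v x₀ hB hm hsm hform
  obtain ⟨l, P, hl2, hP, hharm, hrep⟩ := hform
  rcases Nat.even_or_odd l with hl | hl
  · exact heven v x₀ hB hm hsm ⟨l, P, hl2, hl, hP, hharm, hrep⟩
  · exact singleDegreeRung_odd v x₀ hB hm hsm ⟨l, P, hl2, hl, hP, hharm, hrep⟩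

/-- **Conversely the rung gives its even-degree half** (drop the parity conjunct). [folklore] -/
theorem even_of_stubSingleDegreeRung (h : StubSingleDegreeRung) :
    ∀ (v : ℝ → EuclideanSpace ℝ (Fin 3) → EuclideanSpace ℝ (Fin 3)) (x₀ : EuclideanSpace ℝ (Fin 3)),
      Literature.Analysis.FluidPDE.IsBoundedAncientMildSolution 1 v →
      (∀ t < 0, AEStronglyMeasurable (v t) volume) →
      ContDiffOn ℝ (⊤ : ℕ∞) (Function.uncurry v) (Set.Iio 0 ×ˢ Set.univ) →
      (∃ (l : ℕ) (P : MvPolynomial (Fin 3) ℝ), 2 ≤ l ∧ Even l ∧ P.IsHomogeneous l ∧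
        (∀ y : EuclideanSpace ℝ (Fin 3),
          Laplacian.laplacian (fun z : EuclideanSpace ℝ (Fin 3) => MvPolynomial.eval (fun i => z i) P) y = 0) ∧
        ∀ t < 0, ∃ (g : ℝ → ℝ) (φ : EuclideanSpace ℝ (Fin 3) → ℝ), ∀ x,
          v t x = gradient φ x + (g ‖x - x₀‖ * MvPolynomial.eval (fun i => (x - x₀) i) P) • (x - x₀)) →
      ∀ t < 0, ∃ b : EuclideanSpace ℝ (Fin 3), ∀ x, v t x = b := by
  intro v x₀ hB hm hsm hform
  obtain ⟨l, P, hl2, _, hP, hharm, hrep⟩ := hform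
  exact h v x₀ hB hm hsm ⟨l, P, hl2, hP, hharm, hrep⟩

/-- **THE RUNG IS ITS EVEN HALF (exactness).** `StubSingleDegreeRung ↔` (its registered text with the extra conjunct `Even l`); the odd
half is discharged by `singleDegreeRung_odd` (p798877). Together with `stubSingleDegreeRung_of_stubScalarLiouville` (rung ⊆ wall,
p794497) the open part of the BC5 rung of crux 1222 is exactly the even-degree single-mode Liouville statement. [folklore] -/
theorem stubSingleDegreeRung_iff_even :
    StubSingleDegreeRung ↔
    ∀ (v : ℝ → EuclideanSpace ℝ (Fin 3) → EuclideanSpace ℝ (Fin 3)) (x₀ : EuclideanSpace ℝ (Fin 3)),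
      Literature.Analysis.FluidPDE.IsBoundedAncientMildSolution 1 v →
      (∀ t < 0, AEStronglyMeasurable (v t) volume) →
      ContDiffOn ℝ (⊤ : ℕ∞) (Function.uncurry v) (Set.Iio 0 ×ˢ Set.univ) →
      (∃ (l : ℕ) (P : MvPolynomial (Fin 3) ℝ), 2 ≤ l ∧ Even l ∧ P.IsHomogeneous l ∧
        (∀ y : EuclideanSpace ℝ (Fin 3),
          Laplacian.laplacian (fun z : EuclideanSpace ℝ (Fin 3) => MvPolynomial.eval (fun i => z i) P) y = 0) ∧
        ∀ t < 0, ∃ (g : ℝ → ℝ) (φ : EuclideanSpace ℝ (Fin 3) → ℝ), ∀ x,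
          v t x = gradient φ x + (g ‖x - x₀‖ * MvPolynomial.eval (fun i => (x - x₀) i) P) • (x - x₀)) →
      ∀ t < 0, ∃ b : EuclideanSpace ℝ (Fin 3), ∀ x, v t x = b :=
  ⟨even_of_stubSingleDegreeRung, stubSingleDegreeRung_of_even⟩

end Summit.NavierStokesRegularity.NavierStokesRegularity.Theorems.PoloidalLiouville.Antidynamo

end
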